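import Mathlib.Combinatorics.SimpleGraph.Maps
import Mathlib.Data.Fintype.Card
import Mathlib.Data.Finset.Card
import Literature.Combinatorics.SimpleGraph.SwitchingEquivalentGraph
import HarnessLib

/-!
# Forced traces of sections (Laubner 2011, Lemmas 3.3.5–3.3.6) and the switching-equivalent graph is half-bounded

Third step of the Corneil–Goldberg section machinery [CorneilGoldberg1984] after
[Laubner2011, §3.3.2], undirected case. Laubner argues inside the switching-equivalent graph
`G_P`, using only that it carries an EQUITABLE colouring in which every vertex sees AT MOST HALF of
every colour class; we therefore state the two lemmas for an arbitrary graph `K` with these two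
properties (`IsEquitable K ρ` and the HALF BOUND `∀ u d, 2 * adjCount K ρ u d ≤ cellCard ρ d`) and
prove separately that `G_P` has them
(`isEquitable_swGraph`, `halfBounded_swGraph`, via the count formula
`adjCount_swGraph`).

* `IsSection.mem_of_adj` (the first half of [Laubner2011, Lemma 3.3.5]): if `2 n_{ij} < |P_j|`
  then a section `H` contains every `P_j`-neighbour of `H ∩ P_i`.
* `IsSection.mem_iff_exists_adj` (**Lemma 3.3.5**): if moreover `0 < n_{ij}`, then
  `H ∩ P_j` IS the `P_j`-neighbourhood of `H ∩ P_i`.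
* `IsSection.mem_of_mem_adj` (**Lemma 3.3.6**): if no block is an exact half (`2 n_{ud} ≠ |P_d|`
  throughout) then every section is closed under adjacency, i.e. a union of connected components.

## References

* B. Laubner, PhD thesis, HU Berlin 2011, doi:10.18452/16335, Lemmas 3.3.5, 3.3.6; read
  pp. 45–46. [Laubner2011]
* D. G. Corneil, M. K. Goldberg, J. Algorithms 5 (1984) 345–362. [CorneilGoldberg1984]
-/

namespace Literature.Combinatorics.SimpleGraph

open _root_.SimpleGraph Finset

universe u

variable {V : Type u} [Fintype V] [DecidableEq V]

omit [DecidableEq V] in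
/-- Counting with a finset. [folklore] -/
private theorem natCard_subtype'' (p : V → Prop) [DecidablePred p] :
    Nat.card {w : V // p w} = (univ.filter p).card := by
  rw [Nat.card_eq_fintype_card, Fintype.card_subtype]

section Generic

variable (K : _root_.SimpleGraph V) [DecidableRel K.Adj] {κ : Type*} [DecidableEq κ] (ρ : V → κ)

variable {K ρ}

omit [DecidableEq V] in
/-- `adjCount` is at most the class size. [folklore] -/
theorem adjCount_le_cellCard (u : V) (d : κ) : adjCount K ρ u d ≤ cellCard ρ d :=
  card_le_card fun w hw => by
    simp only [mem_filter, mem_univ, true_and] at hw ⊢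
    exact hw.2

omit [DecidableEq V] in
/-- Equation (N) for two vertices: `|P_{ρ u}| · n_u(ρ v) = |P_{ρ v}| · n_v(ρ u)`. [cite: Laubner2011, §3.3.2 (N)] -/
theorem IsEquitable.cellCard_mul_adjCount (hρ : IsEquitable K ρ) (u v : V) :
    cellCard ρ (ρ u) * adjCount K ρ u (ρ v) = cellCard ρ (ρ v) * adjCount K ρ v (ρ u) := by
  rw [← hρ.crossEdges_eq, ← hρ.crossEdges_eq, crossEdges_comm]

/-- **First half of Lemma 3.3.5**: if `2 n_{ij} < |P_j|` (for `i = ρ u₀`), a section `H` contains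
every vertex of `P_j` adjacent to a vertex of `H ∩ P_i`. [cite: Laubner2011, Lemma 3.3.5] -/
theorem IsSection.mem_of_adj (hρ : IsEquitable K ρ) (hhalf : ∀ (u : V) (d : κ), 2 * adjCount K ρ u d ≤ cellCard ρ d) {H : Set V}
    [DecidablePred (· ∈ H)] (hH : IsSection K ρ H) {u₀ : V} {j : κ}
    (h2 : 2 * adjCount K ρ u₀ j < cellCard ρ j) {u v : V} (hu : ρ u = ρ u₀) (huH : u ∈ H)
    (hv : ρ v = j) (hadj : K.Adj u v) : v ∈ H := by
  by_contra hvH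
  -- (1) the block `(H ∩ P_i) × (P_j \ H)` is full
  have full : ∀ {u' v' : V}, ρ u' = ρ u₀ → u' ∈ H → ρ v' = j → v' ∉ H → K.Adj u' v' := by
    intro u' v' hu' hu'H hv' hv'H
    exact (hH (hu.trans hu'.symm) (hv.trans hv'.symm) (iff_of_true huH hu'H) (iff_of_false hvH hv'H)
      (fun h => hvH (h.1 huH))).1 hadj
  -- (2) hence `|P_j \ H| ≤ n_{ij}` and so `2 |P_j \ H| < |P_j|`
  set Out : Finset V := univ.filter fun w => ρ w = j ∧ w ∉ H with hOut
  have hOut_le : ∀ {u' : V}, ρ u' = ρ u₀ → u' ∈ H → Out.card ≤ adjCount K ρ u' j := by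
    intro u' hu' hu'H
    refine card_le_card fun w hw => ?_
    simp only [hOut, mem_filter, mem_univ, true_and] at hw ⊢
    exact ⟨full hu' hu'H hw.1 hw.2, hw.1⟩
  have hn : ∀ {u' : V}, ρ u' = ρ u₀ → adjCount K ρ u' j = adjCount K ρ u₀ j := fun hu' => hρ.adjCount_eq hu' j
  have h2Out : 2 * Out.card < cellCard ρ j := by
    have := hOut_le hu huH
    rw [hn hu] at this
    omega
  -- (3) no vertex of `P_i \ H` is adjacent to a vertex of `P_j ∩ H`
  have noadj : ∀ {w z : V}, ρ w = ρ u₀ → w ∉ H → ρ z = j → z ∈ H → ¬ K.Adj w z := by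
    intro w z hw hwH hz hzH hwz
    -- the block `(P_i \ H) × (P_j ∩ H)` would be full, giving `w` more than `|P_j| / 2` neighbours
    have hIn : (univ.filter fun y => ρ y = j ∧ y ∈ H).card ≤ adjCount K ρ w j := by
      refine card_le_card fun y hy => ?_
      simp only [mem_filter, mem_univ, true_and] at hy ⊢
      refine ⟨(hH (rfl : ρ w = ρ w) (hz.trans hy.1.symm) Iff.rfl (iff_of_true hzH hy.2)
        (fun h => hwH (h.2 hzH))).1 hwz, hy.1⟩
    have hsplit : (univ.filter fun y => ρ y = j ∧ y ∈ H).card + Out.card = cellCard ρ j := by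
      rw [hOut, cellCard, ← card_union_of_disjoint]
      · congr 1
        ext y
        simp only [mem_union, mem_filter, mem_univ, true_and]
        tauto
      · rw [Finset.disjoint_left]
        intro y hy hy'
        simp only [mem_filter, mem_univ, true_and] at hy hy'
        exact hy'.2 hy.2
    have := hhalf w j
    rw [hn hw] at hIn
    omega
  -- (4) every vertex of `P_i` is adjacent to `v`
  have hall : ∀ w : V, ρ w = ρ u₀ → K.Adj w v := by
    intro w hw
    by_cases hwH : w ∈ H
    · exact full hw hwH hv hvH
    · -- `N(w) ∩ P_j ⊆ P_j \ H` has `n_{ij} ≥ |P_j \ H|` elements, so it is all of `P_j \ H`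
      have hsub : (univ.filter fun y => K.Adj w y ∧ ρ y = j) ⊆ Out := fun y hy => by
        simp only [hOut, mem_filter, mem_univ, true_and] at hy ⊢
        exact ⟨hy.2, fun hyH => noadj hw hwH hy.2 hyH hy.1⟩
      have hcard : Out.card ≤ (univ.filter fun y => K.Adj w y ∧ ρ y = j).card := by
        have := hOut_le hu huH
        rw [hn hu, ← hn hw] at this
        exact this
      have heq := eq_of_subset_of_card_le hsub hcard
      have hvOut : v ∈ Out := by simp [hOut, hv, hvH]
      rw [← heq] at hvOut
      exact (mem_filter.1 hvOut).2.1
  -- (5) so `v` sees all of `P_i`, contradicting the half bound at `v`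
  have hcnt : cellCard ρ (ρ u₀) ≤ adjCount K ρ v (ρ u₀) :=
    card_le_card fun w hw => by
      simp only [mem_filter, mem_univ, true_and] at hw ⊢
      exact ⟨(hall w hw).symm, hw⟩
  have hpos : 0 < cellCard ρ (ρ u₀) := card_pos.2 ⟨u₀, by simp⟩
  have := hhalf v (ρ u₀)
  omega

/-- **Lemma 3.3.5 (forced traces).** If `0 < n_{ij}` and `2 n_{ij} < |P_j|` (`i = ρ u₀`), then for a
section `H` the trace `H ∩ P_j` is exactly the set of `P_j`-neighbours of `H ∩ P_i`. [cite: Laubner2011, Lemma 3.3.5] -/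
theorem IsSection.mem_iff_exists_adj (hρ : IsEquitable K ρ) (hhalf : ∀ (u : V) (d : κ), 2 * adjCount K ρ u d ≤ cellCard ρ d) {H : Set V}
    [DecidablePred (· ∈ H)] (hH : IsSection K ρ H) {u₀ : V} {j : κ}
    (h0 : 0 < adjCount K ρ u₀ j) (h2 : 2 * adjCount K ρ u₀ j < cellCard ρ j) {v : V} (hv : ρ v = j) :
    v ∈ H ↔ ∃ u ∈ H, ρ u = ρ u₀ ∧ K.Adj u v := by
  refine ⟨fun hvH => ?_, fun ⟨u, huH, hu, hadj⟩ => hH.mem_of_adj hρ hhalf h2 hu huH hv hadj⟩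
  by_contra hno
  -- `v` has a neighbour in `P_i` (Equation (N)), necessarily outside `H`; apply the first half to `Hᶜ`
  have hvi : 0 < adjCount K ρ v (ρ u₀) := by
    have h := hρ.cellCard_mul_adjCount u₀ v
    rw [hv] at h
    have hpos : 0 < cellCard ρ (ρ u₀) * adjCount K ρ u₀ j :=
      Nat.mul_pos (card_pos.2 ⟨u₀, by simp⟩) h0
    rw [h] at hpos
    exact pos_of_mul_pos_right hpos (Nat.zero_le _) |> fun h' => Nat.pos_of_mul_pos_left hpos
  obtain ⟨w, hw⟩ := card_pos.1 hvi
  simp only [mem_filter, mem_univ, true_and] at hw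
  have hwH : w ∉ H := fun hwH => hno ⟨w, hwH, hw.2, hw.1.symm⟩
  haveI : DecidablePred (· ∈ Hᶜ) := fun x => show Decidable (x ∉ H) from inferInstance
  have := hH.compl.mem_of_adj hρ hhalf h2 hw.2 (Set.mem_compl hwH) hv hw.1.symm
  exact this hvH

/-- **Lemma 3.3.6**: if no block is an exact half (`2 n_u(d) ≠ |P_d|` for all `u`, `d`), every
section is closed under adjacency — a union of connected components. [cite: Laubner2011, Lemma 3.3.6] -/
theorem IsSection.mem_of_mem_adj (hρ : IsEquitable K ρ) (hhalf : ∀ (u : V) (d : κ), 2 * adjCount K ρ u d ≤ cellCard ρ d)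
    (hne : ∀ (u : V) (d : κ), 2 * adjCount K ρ u d ≠ cellCard ρ d) {H : Set V} [DecidablePred (· ∈ H)]
    (hH : IsSection K ρ H) {u v : V} (huH : u ∈ H) (hadj : K.Adj u v) : v ∈ H := by
  have h1 : 0 < adjCount K ρ u (ρ v) := card_pos.2 ⟨v, by simp [hadj]⟩
  have h2 : 2 * adjCount K ρ u (ρ v) < cellCard ρ (ρ v) :=
    lt_of_le_of_ne (hhalf u (ρ v)) (hne u (ρ v))
  exact hH.mem_of_adj hρ hhalf h2 rfl huH rfl hadj

end Generic

/-! ## The switching-equivalent graph is equitable and half-bounded -/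

section SwGraph

variable {G : _root_.SimpleGraph V} [DecidableRel G.Adj] {κ : Type*} [DecidableEq κ] {ρ : V → κ}

/-- **Neighbour counts in `G_P`**: unchanged off switched blocks, complemented on them.
[cite: Laubner2011, Def. 3.3.2] -/
theorem adjCount_swGraph (u : V) (d : κ) :
    adjCount (swGraph G ρ) ρ u d =
      if Switch G ρ (ρ u) d then cellCard ρ d - (if ρ u = d then 1 else 0) - adjCount G ρ u d
      else adjCount G ρ u d := by
  unfold adjCount
  split_ifs with hs hud
  · -- switched diagonal block: neighbours are the non-neighbours in `P_d \ {u}`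
    have : (univ.filter fun w => (swGraph G ρ).Adj u w ∧ ρ w = d) =
        ((univ.filter fun w => ρ w = d).erase u) \ (univ.filter fun w => G.Adj u w ∧ ρ w = d) := by
      ext w
      simp only [mem_filter, mem_univ, true_and, mem_sdiff, mem_erase, swGraph_adj]
      constructor
      · rintro ⟨⟨hne, h⟩, hw⟩
        rw [hw] at h
        exact ⟨⟨hne.symm, hw⟩, fun h' => (h.1 h'.1) hs⟩
      · rintro ⟨⟨hne, hw⟩, h'⟩
        refine ⟨⟨fun e => hne e.symm, ?_⟩, hw⟩
        rw [hw]
        exact ⟨fun h => absurd ⟨h, hw⟩ h', fun h => absurd hs h⟩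
    rw [this, card_sdiff_of_subset, card_erase_of_mem]
    · rfl
    · simp [hud]
    · intro w hw
      simp only [mem_filter, mem_univ, true_and, mem_erase] at hw ⊢
      exact ⟨fun e => G.ne_of_adj hw.1 e.symm, hw.2⟩
  · -- switched off-diagonal block
    have : (univ.filter fun w => (swGraph G ρ).Adj u w ∧ ρ w = d) =
        (univ.filter fun w => ρ w = d) \ (univ.filter fun w => G.Adj u w ∧ ρ w = d) := by
      ext w
      simp only [mem_filter, mem_univ, true_and, mem_sdiff, swGraph_adj]
      constructor
      · rintro ⟨⟨-, h⟩, hw⟩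
        rw [hw] at h
        exact ⟨hw, fun h' => (h.1 h'.1) hs⟩
      · rintro ⟨hw, h'⟩
        refine ⟨⟨fun e => hud (e ▸ hw.symm ▸ rfl), ?_⟩, hw⟩
        · rw [hw]
          exact ⟨fun h => absurd ⟨h, hw⟩ h', fun h => absurd hs h⟩
    rw [this, card_sdiff_of_subset, Nat.sub_zero]
    · rfl
    · intro w hw
      simp only [mem_filter, mem_univ, true_and] at hw ⊢
      exact hw.2
  · -- unswitched block
    congr 1
    ext w
    simp only [mem_filter, mem_univ, true_and, swGraph_adj]
    constructor
    · rintro ⟨⟨-, h⟩, hw⟩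
      rw [hw] at h
      exact ⟨h.2 hs, hw⟩
    · rintro ⟨h, hw⟩
      refine ⟨⟨G.ne_of_adj h, ?_⟩, hw⟩
      rw [hw]
      exact iff_of_true h hs

/-- **`G_P` carries the same equitable colouring.** [cite: Laubner2011, §3.3.2] -/
theorem isEquitable_swGraph (hρ : IsEquitable G ρ) : IsEquitable (swGraph G ρ) ρ := by
  intro u v huv d
  rw [natCard_subtype'', natCard_subtype'']
  change adjCount (swGraph G ρ) ρ u d = adjCount (swGraph G ρ) ρ v d
  rw [adjCount_swGraph, adjCount_swGraph, huv, hρ.adjCount_eq huv]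

/-- **`G_P` is half-bounded**: every vertex sees at most half of every colour class. [cite: Laubner2011, §3.3.2] -/
theorem halfBounded_swGraph (hρ : IsEquitable G ρ) (u : V) (d : κ) :
    2 * adjCount (swGraph G ρ) ρ u d ≤ cellCard ρ d := by
  rw [adjCount_swGraph]
  have hle := adjCount_le_cellCard (K := G) (ρ := ρ) u d
  by_cases hs : Switch G ρ (ρ u) d
  · rw [if_pos hs]
    rw [switch_iff_of_isEquitable hρ] at hs
    have : cellCard ρ d - (if ρ u = d then 1 else 0) - adjCount G ρ u d ≤ cellCard ρ d - adjCount G ρ u d := by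
      omega
    omega
  · rw [if_neg hs]
    rw [switch_iff_of_isEquitable hρ] at hs
    omega

end SwGraph

end Literature.Combinatorics.SimpleGraph
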